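import Literature.Combinatorics.SimpleGraph.MatchingMinorProjection
import HarnessLib

/-!
# The perfect-matching polynomial and Valiant projections, III: isomorphism invariance

Topic `Combinatorics/SimpleGraph`; sequel to `MatchingMinorProjection.lean` (definition item
`defn-IsMatchingMinor`, wanted API (i)).

`MatchingMinor.IsIsomorphic G G'` is isomorphism of the underlying ABSTRACT graphs on the vertex
set `V = Fin n ⊕ Fin n` (rows `inl`, columns `inr`): the bijection `φ : V ≃ V` preserves
adjacency but need not send rows to rows (it may exchange the colour classes on some connected
components only). Still `PM_{G'}` is obtained from `PM_G` by renaming variables: an edge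
`(i, j)` of `G` goes to the edge of `G'` joining `φ (inl i)` and `φ (inr j)` — read as a
(row, column) pair whichever way round it comes (`isoEdgeMap`) — and perfect matchings of `G`
correspond bijectively to perfect matchings of `G'` (conjugate the fixed-point-free involution of
`V` exchanging the two ends of every matching edge, `matchInv`, by `φ`). Hence
`PM_{G'} = PM_G (x_e ↦ x_{isoEdgeMap φ e})` (`aeval_isoSubst_perfectMatchingPoly`) and `PM_{G'}`
is a Valiant projection of `PM_G` (`IsIsomorphic.isProjection_perfectMatchingPoly`); by symmetry
also the other way round.

## References

* N. Robertson, P. D. Seymour, R. Thomas, *Permanents, Pfaffian orientations, and even directed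
  circuits*, Ann. of Math. 150 (1999) 929–975, §4 ("a graph isomorphic to `H`").
  [RobertsonSeymourThomas1999]
* L. G. Valiant, *Completeness classes in algebra*, STOC 1979 (projections). [Valiant1979]
-/

namespace Literature.Combinatorics.SimpleGraph

open MvPolynomial Equiv Finset Matrix

section Isomorphism

variable {k : Type*} [CommSemiring k] {n : ℕ}

/-! ### Adjacency bookkeeping -/

/-- `Adj` is symmetric. [folklore] -/
theorem Adj.symm {G : Finset (Fin n × Fin n)} {a b : Fin n ⊕ Fin n} (h : Adj G a b) :
    Adj G b a := by
  rcases a with i | j <;> rcases b with i' | j' <;> simp_all [Adj]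

/-- Two row vertices are never adjacent. [folklore] -/
@[simp] theorem adj_inl_inl (G : Finset (Fin n × Fin n)) (i i' : Fin n) :
    Adj G (Sum.inl i) (Sum.inl i') ↔ False := by simp [Adj]

/-- Two column vertices are never adjacent. [folklore] -/
@[simp] theorem adj_inr_inr (G : Finset (Fin n × Fin n)) (j j' : Fin n) :
    Adj G (Sum.inr j) (Sum.inr j') ↔ False := by simp [Adj]

/-- Row `i` and column `j` are adjacent iff `(i, j)` is an edge. [folklore] -/
@[simp] theorem adj_inl_inr (G : Finset (Fin n × Fin n)) (i j : Fin n) :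
    Adj G (Sum.inl i) (Sum.inr j) ↔ (i, j) ∈ G := by simp [Adj]

/-- Column `j` and row `i` are adjacent iff `(i, j)` is an edge. [folklore] -/
@[simp] theorem adj_inr_inl (G : Finset (Fin n × Fin n)) (i j : Fin n) :
    Adj G (Sum.inr j) (Sum.inl i) ↔ (i, j) ∈ G := by simp [Adj]

/-- `IsIsomorphic` is symmetric. [folklore] -/
theorem IsIsomorphic.symm {G G' : Finset (Fin n × Fin n)} (h : IsIsomorphic G G') :
    IsIsomorphic G' G := by
  obtain ⟨φ, hφ⟩ := h
  refine ⟨φ.symm, fun a b => ?_⟩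
  rw [hφ, φ.apply_symm_apply, φ.apply_symm_apply]

/-- The (row, column) pair of an adjacent pair of vertices, whichever way round it is given
(junk on same-side pairs). [folklore] -/
def toEdge : Fin n ⊕ Fin n → Fin n ⊕ Fin n → Fin n × Fin n
  | Sum.inl i, Sum.inr j => (i, j)
  | Sum.inr j, Sum.inl i => (i, j)
  | Sum.inl i, Sum.inl i' => (i, i')
  | Sum.inr j, Sum.inr j' => (j, j')

/-- The index carried by a vertex (its row number or its column number). [folklore] -/
def vertexIndex : Fin n ⊕ Fin n → Fin n := Sum.elim id id

/-! ### Perfect matchings as involutions and their transport along an isomorphism -/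

/-- The involution of `V = Fin n ⊕ Fin n` exchanging the two ends of every edge of the perfect
matching `σ` (column `j` matched to row `σ j`). [folklore] -/
def matchInv (σ : Perm (Fin n)) : Fin n ⊕ Fin n → Fin n ⊕ Fin n :=
  Sum.elim (fun i => Sum.inr (σ.symm i)) (fun j => Sum.inl (σ j))

/-- The partner of the row `i` is the column `σ⁻¹ i`. [folklore] -/
@[simp] theorem matchInv_inl (σ : Perm (Fin n)) (i : Fin n) :
    matchInv σ (Sum.inl i) = Sum.inr (σ.symm i) := rfl

/-- The partner of the column `j` is the row `σ j`. [folklore] -/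
@[simp] theorem matchInv_inr (σ : Perm (Fin n)) (j : Fin n) :
    matchInv σ (Sum.inr j) = Sum.inl (σ j) := rfl

/-- `matchInv σ` is an involution. [folklore] -/
@[simp] theorem matchInv_matchInv (σ : Perm (Fin n)) (v : Fin n ⊕ Fin n) :
    matchInv σ (matchInv σ v) = v := by
  rcases v with i | j <;> simp

/-- Every vertex is adjacent to its partner in a perfect matching of `G`. [folklore] -/
theorem adj_matchInv {G : Finset (Fin n × Fin n)} {σ : Perm (Fin n)}
    (hσ : ∀ j, (σ j, j) ∈ G) (v : Fin n ⊕ Fin n) : Adj G v (matchInv σ v) := by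
  rcases v with i | j
  · simpa using hσ (σ.symm i)
  · simpa using hσ j

/-- The edge of `σ` at the vertex `w`, read off the involution: it is an edge `(σ j', j')`.
[folklore] -/
theorem toEdge_matchInv (σ : Perm (Fin n)) (w : Fin n ⊕ Fin n) :
    ∃ j', toEdge (matchInv σ w) w = (σ j', j') := by
  rcases w with i | j
  · exact ⟨σ.symm i, by simp [toEdge]⟩
  · exact ⟨j, by simp [toEdge]⟩

/-- Transport of the matching involution along `φ`: `φ ∘ matchInv σ ∘ φ⁻¹`. [folklore] -/
def transfer (φ : Fin n ⊕ Fin n ≃ Fin n ⊕ Fin n) (σ : Perm (Fin n)) :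
    Fin n ⊕ Fin n → Fin n ⊕ Fin n :=
  fun v => φ (matchInv σ (φ.symm v))

/-- `transfer φ σ` is an involution. [folklore] -/
@[simp] theorem transfer_transfer (φ : Fin n ⊕ Fin n ≃ Fin n ⊕ Fin n) (σ : Perm (Fin n))
    (v : Fin n ⊕ Fin n) : transfer φ σ (transfer φ σ v) = v := by
  simp [transfer]

variable {G G' : Finset (Fin n × Fin n)} {φ : Fin n ⊕ Fin n ≃ Fin n ⊕ Fin n}

/-- Along an isomorphism, every vertex of `G'` is adjacent to its transported partner.
[folklore] -/
theorem adj_transfer (hφ : ∀ a b, Adj G a b ↔ Adj G' (φ a) (φ b)) {σ : Perm (Fin n)}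
    (hσ : ∀ j, (σ j, j) ∈ G) (v : Fin n ⊕ Fin n) : Adj G' v (transfer φ σ v) := by
  have h := (hφ _ _).1 (adj_matchInv hσ (φ.symm v))
  rwa [φ.apply_symm_apply] at h

/-- The transported partner of a column of `G'` is a row, joined to it by an edge of `G'`.
[folklore] -/
theorem transfer_inr (hφ : ∀ a b, Adj G a b ↔ Adj G' (φ a) (φ b)) {σ : Perm (Fin n)}
    (hσ : ∀ j, (σ j, j) ∈ G) (j : Fin n) :
    ∃ i, transfer φ σ (Sum.inr j) = Sum.inl i ∧ (i, j) ∈ G' := by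
  have h := adj_transfer hφ hσ (Sum.inr j)
  rcases hv : transfer φ σ (Sum.inr j) with i | j'
  · rw [hv] at h; exact ⟨i, rfl, by simpa using h⟩
  · rw [hv] at h; simp at h

/-- The transported partner of a row of `G'` is a column, joined to it by an edge of `G'`.
[folklore] -/
theorem transfer_inl (hφ : ∀ a b, Adj G a b ↔ Adj G' (φ a) (φ b)) {σ : Perm (Fin n)}
    (hσ : ∀ j, (σ j, j) ∈ G) (i : Fin n) :
    ∃ j, transfer φ σ (Sum.inl i) = Sum.inr j ∧ (i, j) ∈ G' := by
  have h := adj_transfer hφ hσ (Sum.inl i)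
  rcases hv : transfer φ σ (Sum.inl i) with i' | j
  · rw [hv] at h; simp at h
  · rw [hv] at h; exact ⟨j, rfl, by simpa using h⟩

/-- **The perfect matching of `G'` corresponding to the perfect matching `σ` of `G` under the
isomorphism `φ`**: column `j` of `G'` is matched to the row `φ σ φ⁻¹`-partner of `j`.
[folklore] -/
def isoPerm (hφ : ∀ a b, Adj G a b ↔ Adj G' (φ a) (φ b)) (σ : Perm (Fin n))
    (hσ : ∀ j, (σ j, j) ∈ G) : Perm (Fin n) where
  toFun j := vertexIndex (transfer φ σ (Sum.inr j))
  invFun i := vertexIndex (transfer φ σ (Sum.inl i))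
  left_inv j := by
    obtain ⟨i, hi, -⟩ := transfer_inr hφ hσ j
    have h2 : transfer φ σ (Sum.inl i) = Sum.inr j := by rw [← hi, transfer_transfer]
    simp [hi, h2, vertexIndex]
  right_inv i := by
    obtain ⟨j, hj, -⟩ := transfer_inl hφ hσ i
    have h2 : transfer φ σ (Sum.inr j) = Sum.inl i := by rw [← hj, transfer_transfer]
    simp [hj, h2, vertexIndex]

/-- The matching involution of `isoPerm` is the transported involution
`φ ∘ matchInv σ ∘ φ⁻¹`. [folklore] -/
theorem matchInv_isoPerm (hφ : ∀ a b, Adj G a b ↔ Adj G' (φ a) (φ b)) (σ : Perm (Fin n))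
    (hσ : ∀ j, (σ j, j) ∈ G) (v : Fin n ⊕ Fin n) :
    matchInv (isoPerm hφ σ hσ) v = transfer φ σ v := by
  rcases v with i | j
  · obtain ⟨j, hj, -⟩ := transfer_inl hφ hσ i
    rw [matchInv_inl, hj]
    simp only [Sum.inr.injEq]
    show vertexIndex (transfer φ σ (Sum.inl i)) = j
    rw [hj]; rfl
  · obtain ⟨i, hi, -⟩ := transfer_inr hφ hσ j
    rw [matchInv_inr, hi]
    simp only [Sum.inl.injEq]
    show vertexIndex (transfer φ σ (Sum.inr j)) = i
    rw [hi]; rfl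

/-- `isoPerm` is a perfect matching of `G'`. [folklore] -/
theorem isoPerm_mem (hφ : ∀ a b, Adj G a b ↔ Adj G' (φ a) (φ b)) (σ : Perm (Fin n))
    (hσ : ∀ j, (σ j, j) ∈ G) (j : Fin n) : (isoPerm hφ σ hσ j, j) ∈ G' := by
  obtain ⟨i, hi, hG'⟩ := transfer_inr hφ hσ j
  have : isoPerm hφ σ hσ j = i := by
    show vertexIndex (transfer φ σ (Sum.inr j)) = i
    rw [hi]; rfl
  rwa [this]

/-- The inverse isomorphism, in the form consumed by the lemmas above. [folklore] -/
theorem adj_iff_symm (hφ : ∀ a b, Adj G a b ↔ Adj G' (φ a) (φ b)) (a b : Fin n ⊕ Fin n) :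
    Adj G' a b ↔ Adj G (φ.symm a) (φ.symm b) := by
  rw [hφ, φ.apply_symm_apply, φ.apply_symm_apply]

/-- Transporting back along `φ⁻¹` recovers `σ`. [folklore] -/
theorem isoPerm_symm_isoPerm (hφ : ∀ a b, Adj G a b ↔ Adj G' (φ a) (φ b)) (σ : Perm (Fin n))
    (hσ : ∀ j, (σ j, j) ∈ G) :
    isoPerm (φ := φ.symm) (adj_iff_symm hφ) (isoPerm hφ σ hσ) (isoPerm_mem hφ σ hσ) =
      σ := by
  refine Equiv.ext fun j => ?_
  show (vertexIndex (transfer φ.symm (isoPerm hφ σ hσ) (Sum.inr j)) : Fin n) = σ j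
  simp only [transfer, Equiv.symm_symm, matchInv_isoPerm, Equiv.symm_apply_apply, matchInv_inr]
  rfl

/-! ### The edge renaming and the substitution -/

/-- **The edge map of an isomorphism**: the edge `(i, j)` of `G` goes to the edge of `G'`
joining `φ (inl i)` and `φ (inr j)`, as a (row, column) pair (junk off the edges of `G`).
[folklore] -/
def isoEdgeMap (φ : Fin n ⊕ Fin n ≃ Fin n ⊕ Fin n) (e : Fin n × Fin n) : Fin n × Fin n :=
  toEdge (φ (Sum.inl e.1)) (φ (Sum.inr e.2))

/-- The isomorphism substitution `x_e ↦ x_{isoEdgeMap φ e}` (variables to variables).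
[folklore] -/
noncomputable def isoSubst (φ : Fin n ⊕ Fin n ≃ Fin n ⊕ Fin n) :
    Fin n × Fin n → MvPolynomial (Fin n × Fin n) k :=
  fun e => MvPolynomial.X (isoEdgeMap φ e)

/-- `toEdge` is injective on adjacent pairs up to swapping the pair. [folklore] -/
theorem toEdge_eq_toEdge {a b a' b' : Fin n ⊕ Fin n} (hab : Adj G' a b) (hab' : Adj G' a' b')
    (h : toEdge a b = toEdge a' b') : (a = a' ∧ b = b') ∨ (a = b' ∧ b = a') := by
  rcases a with i | j <;> rcases b with i₂ | j₂ <;> simp at hab <;>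
    rcases a' with i' | j' <;> rcases b' with i₂' | j₂' <;> simp at hab' <;>
    simp_all [toEdge]

/-- The edge map of an isomorphism is injective on the edges of `G`. [folklore] -/
theorem isoEdgeMap_injOn (hφ : ∀ a b, Adj G a b ↔ Adj G' (φ a) (φ b)) :
    Set.InjOn (isoEdgeMap φ) (G : Set (Fin n × Fin n)) := by
  intro e he e' he' h
  have ha : Adj G' (φ (Sum.inl e.1)) (φ (Sum.inr e.2)) := (hφ _ _).1 (by simpa using he)
  have ha' : Adj G' (φ (Sum.inl e'.1)) (φ (Sum.inr e'.2)) := (hφ _ _).1 (by simpa using he')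
  rcases toEdge_eq_toEdge ha ha' h with ⟨h1, h2⟩ | ⟨h1, -⟩
  · exact Prod.ext (Sum.inl_injective (φ.injective h1)) (Sum.inr_injective (φ.injective h2))
  · exact absurd (φ.injective h1) Sum.inl_ne_inr

/-- The edge set of the perfect matching `σ`. [folklore] -/
def matchingEdges (σ : Perm (Fin n)) : Finset (Fin n × Fin n) :=
  Finset.univ.image fun j => (σ j, j)

/-- Membership in the edge set of a matching. [folklore] -/
theorem mem_matchingEdges (σ : Perm (Fin n)) (e : Fin n × Fin n) :
    e ∈ matchingEdges σ ↔ ∃ j, (σ j, j) = e := by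
  simp [matchingEdges]

/-- A perfect matching of `K_{n,n}` has `n` edges. [folklore] -/
theorem card_matchingEdges (σ : Perm (Fin n)) : (matchingEdges σ).card = n := by
  rw [matchingEdges, Finset.card_image_of_injective _ (fun j j' h => (Prod.ext_iff.1 h).2)]
  simp

/-- A product over the columns is a product over the matching edges. [folklore] -/
theorem prod_matchingEdges {M : Type*} [CommMonoid M] (σ : Perm (Fin n))
    (f : Fin n × Fin n → M) :
    ∏ j, f (σ j, j) = ∏ e ∈ matchingEdges σ, f e := by
  rw [matchingEdges, Finset.prod_image (fun j _ j' _ h => (Prod.ext_iff.1 h).2)]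

/-- **The edge map sends the matching `σ` onto the matching `isoPerm σ`.** [folklore] -/
theorem image_isoEdgeMap_matchingEdges (hφ : ∀ a b, Adj G a b ↔ Adj G' (φ a) (φ b))
    (σ : Perm (Fin n)) (hσ : ∀ j, (σ j, j) ∈ G) :
    (matchingEdges σ).image (isoEdgeMap φ) = matchingEdges (isoPerm hφ σ hσ) := by
  apply Finset.eq_of_subset_of_card_le
  · intro e he
    rw [Finset.mem_image] at he
    obtain ⟨e₀, he₀, rfl⟩ := he
    obtain ⟨j, rfl⟩ := (mem_matchingEdges σ e₀).1 he₀
    -- `isoEdgeMap φ (σ j, j) = toEdge (transfer φ σ w) w` with `w = φ (inr j)`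
    have hw : φ (Sum.inl (σ j)) = transfer φ σ (φ (Sum.inr j)) := by
      simp [transfer]
    rw [mem_matchingEdges]
    obtain ⟨j', hj'⟩ := toEdge_matchInv (isoPerm hφ σ hσ) (φ (Sum.inr j))
    refine ⟨j', ?_⟩
    rw [← hj', matchInv_isoPerm, ← hw]
    rfl
  · rw [card_matchingEdges, Finset.card_image_of_injOn, card_matchingEdges]
    exact (isoEdgeMap_injOn hφ).mono fun e he => by
      obtain ⟨j, rfl⟩ := (mem_matchingEdges σ e).1 (Finset.mem_coe.1 he)
      exact hσ j

/-- The monomial of `σ` is renamed to the monomial of `isoPerm σ`. [folklore] -/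
theorem prod_X_isoEdgeMap (hφ : ∀ a b, Adj G a b ↔ Adj G' (φ a) (φ b)) (σ : Perm (Fin n))
    (hσ : ∀ j, (σ j, j) ∈ G) :
    ∏ j, (MvPolynomial.X (isoEdgeMap φ (σ j, j)) : MvPolynomial (Fin n × Fin n) k) =
      ∏ j, MvPolynomial.X (isoPerm hφ σ hσ j, j) := by
  rw [prod_matchingEdges σ (fun e => (MvPolynomial.X (isoEdgeMap φ e) : MvPolynomial _ k)),
    prod_matchingEdges (isoPerm hφ σ hσ) (fun e => (MvPolynomial.X e : MvPolynomial _ k)),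
    ← image_isoEdgeMap_matchingEdges hφ σ hσ, Finset.prod_image]
  exact (isoEdgeMap_injOn hφ).mono fun e he => by
    obtain ⟨j, rfl⟩ := (mem_matchingEdges σ e).1 (Finset.mem_coe.1 he)
    exact hσ j

/-- **Isomorphic graphs have the same perfect-matching polynomial up to renaming**:
`PM_{G'} = PM_G (x_e ↦ x_{isoEdgeMap φ e})` for an isomorphism `φ` from `G` to `G'`.
[folklore] -/
theorem aeval_isoSubst_perfectMatchingPoly (hφ : ∀ a b, Adj G a b ↔ Adj G' (φ a) (φ b)) :
    aeval (isoSubst (k := k) φ) (perfectMatchingPoly G k) = perfectMatchingPoly G' k := by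
  -- the target `PM_{G'}` as a sum over the perfect matchings of `G'`
  have hR : (Matrix.of fun i j => if (i, j) ∈ G' then
        (MvPolynomial.X (i, j) : MvPolynomial (Fin n × Fin n) k) else 0).permanent =
      ∑ σ ∈ Finset.univ.filter (fun σ : Perm (Fin n) => ∀ j, (σ j, j) ∈ G'),
        ∏ j, MvPolynomial.X (σ j, j) := by
    rw [permanent_of_ite, Finset.sum_filter]
    exact Finset.sum_congr rfl fun σ _ => by congr
  rw [aeval_perfectMatchingPoly, perfectMatchingPoly_eq_permanent, hR,
    permanent_of_ite (fun i j => (i, j) ∈ G) (fun i j => isoSubst (k := k) φ (i, j))]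
  simp only [isoSubst]
  rw [← Finset.sum_filter]
  refine Finset.sum_bij' (fun σ hσ => isoPerm hφ σ (Finset.mem_filter.1 hσ).2)
    (fun σ' hσ' => isoPerm (φ := φ.symm) (adj_iff_symm hφ) σ' (Finset.mem_filter.1 hσ').2)
    (fun σ hσ => Finset.mem_filter.2 ⟨Finset.mem_univ _, isoPerm_mem hφ σ _⟩)
    (fun σ' hσ' => Finset.mem_filter.2 ⟨Finset.mem_univ _, isoPerm_mem _ σ' _⟩)
    (fun σ hσ => isoPerm_symm_isoPerm hφ σ _)
    (fun σ' hσ' => ?_)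
    (fun σ hσ => prod_X_isoEdgeMap hφ σ _)
  -- right inverse: the same statement for `φ.symm`
  have h := isoPerm_symm_isoPerm (φ := φ.symm) (adj_iff_symm hφ) σ' (Finset.mem_filter.1 hσ').2
  convert h using 2
  exact (Equiv.symm_symm φ).symm

/-- **Isomorphic graphs: `PM_{G'}` is a projection of `PM_G`** (a renaming of variables), for
`MatchingMinor.IsIsomorphic G G'` (isomorphism of the underlying abstract graphs). [folklore] -/
theorem IsIsomorphic.isProjection_perfectMatchingPoly (h : IsIsomorphic G G') :
    Literature.Computability.AlgebraicComplexity.IsProjection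
      (perfectMatchingPoly G' k) (perfectMatchingPoly G k) := by
  obtain ⟨φ, hφ⟩ := h
  exact ⟨isoSubst φ, fun e => Or.inl ⟨_, rfl⟩,
    (aeval_isoSubst_perfectMatchingPoly hφ).symm⟩

/-- … and, by symmetry, `PM_G` is a projection of `PM_{G'}`. [folklore] -/
theorem IsIsomorphic.isProjection_perfectMatchingPoly' (h : IsIsomorphic G G') :
    Literature.Computability.AlgebraicComplexity.IsProjection
      (perfectMatchingPoly G k) (perfectMatchingPoly G' k) :=
  h.symm.isProjection_perfectMatchingPoly

end Isomorphism

end Literature.Combinatorics.SimpleGraph
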